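import Summits.CriticalPhenomena.PercolationContinuityZ3.Theorems.PercNearOneGluingNoHeavyLowerTailSahiGridPatternStarLiteral

/-!
# `NoHeavyLowerTail` (crux stmt-CriticalPhenomena-4575), Sahi programme P1: **THE STAR THEOREM FOR LITERAL BLOCKS — arbitrary axis
# positions, and the value level**: Kahn's `E₃ ≥ 0` when one event is a CLAUSE ∨ MONOMIAL (read-once)

Support file (Sahi cell, seat `prim-sahi-p1`, generation 22; `--supports stmt-CriticalPhenomena-4575`).  Pure proofs, no definitions,
no `sorry`, standard axioms.  Continuation of `…SahiGridPatternStarLiteral` (block form), with the re-indexing tools of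
`…TwoOrthantGeneral` (`exists_block_equiv`, `sStarD_nonneg_transfer`) and the grid pull-back machinery of `…OrthantGrid`.

RESULTS.  `sStarD_clauseOrthant_nonneg` (every `d`): for disjoint `T, S ⊆ Fin d`, thresholds `u` nonzero on `T`, and a flag `w`, the up-set
`{p ∈ [3]^d : (∃ i ∈ T, u i ≤ p i) ∨ (w ∧ ∀ a ∈ S, u a ≤ p a)}` is a good first slot of the pattern functional (`sStarD ≥ 0` against all
up-sets).  VALUE LEVEL (`Ssym_nonneg_clauseOrthant`, `latticeE3_gridProd_nonneg_clauseOrthant`, **`sahiE_three_clauseOrthant_nonneg`**): for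
every product probability weight on every grid `[K+1]^d`, disjoint `T, S`, thresholds `c`, and all increasing `B, C`:
  `0 ≤ E₃(1_A, 1_B, 1_C)`  for  `A = {x : (∃ i ∈ T, c i ≤ x i) ∨ (w ∧ ∀ a ∈ S, c a ≤ x a)}`
— Kahn's Conjecture 5 / Sahi's `C₃` when one of the three increasing events is a read-once monotone DNF all of whose terms but at most one are
single variables (binary cube: `K = 1`; `w = false`: a pure clause `x_{i₁} ∨ … ∨ x_{i_m}`).  Previously in the tree: OR of two ANDs
(`sahiE_three_orOfAnds_nonneg`), one literal of threshold 1 with anything.  Nothing here asserts `PatternPos d` for `d ≥ 4`. [this work]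
-/

namespace Summit.CriticalPhenomena.PercolationContinuityZ3.Theorems.SahiGridPattern

open Finset SahiGrid3 Literature.Probability.LatticeModels Literature.Combinatorics.Sahi2008
open scoped BigOperators

/-! ### Arbitrary axis positions -/

/-- **THE CLAUSE-OR-ORTHANT SLOT IN ARBITRARY POSITION** (every `d`): for disjoint `T, S ⊆ Fin d`, thresholds `u : Fin d → [3]` nonzero on `T`
and `w : Bool`, `0 ≤ sStarD {p : (∃ i ∈ T, u i ≤ p i) ∨ (w ∧ ∀ a ∈ S, u a ≤ p a)} B C` for all up-sets `B, C ⊆ [3]^d`. [this work] -/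
theorem sStarD_clauseOrthant_nonneg {d : ℕ} (T S : Finset (Fin d)) (hdisj : Disjoint T S) (u : Fin d → Fin 3)
    (hu : ∀ i ∈ T, u i ≠ 0) (w : Bool)
    {B C : Finset (Pd d)} (hB : IsUpperSet (B : Set (Pd d))) (hC : IsUpperSet (C : Set (Pd d))) :
    0 ≤ sStarD (univ.filter fun p : Pd d => (∃ i ∈ T, u i ≤ p i) ∨ (w = true ∧ ∀ a ∈ S, u a ≤ p a)) B C := by
  classical
  obtain ⟨e, he1, he2, hs1, hs2⟩ := exists_block_equiv T S hdisj
  set κ : Fin (T.card + S.card) → Bool := fun i => decide (i.val < T.card) with hκ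
  set thr : Fin (T.card + S.card) → Fin 3 := fun i => u (e (Fin.natAdd _ i)) with hthr
  have hκ1 : ∀ i' : Fin T.card, κ (Fin.castAdd S.card i') = true := fun i' => by
    rw [hκ]; simp only [Fin.val_castAdd, decide_eq_true_eq]; exact i'.isLt
  have hκ2 : ∀ j : Fin S.card, κ (Fin.natAdd T.card j) = false := fun j => by
    rw [hκ]; simp only [Fin.val_natAdd, decide_eq_false_iff_not, not_lt]; exact Nat.le_add_right _ _
  have hthr' : ∀ i, κ i = true → thr i ≠ 0 := by
    intro i hi
    rw [hκ] at hi; simp only [decide_eq_true_eq] at hi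
    have ei : i = Fin.castAdd S.card ⟨i.val, hi⟩ := Fin.ext rfl
    rw [ei, hthr]
    exact hu _ (he1 ⟨i.val, hi⟩)
  have hord : ∀ i j, κ i = true → κ j = false → i < j := by
    intro i j hi hj
    rw [hκ] at hi hj; simp only [decide_eq_true_eq] at hi; simp only [decide_eq_false_iff_not, not_lt] at hj
    exact Fin.lt_def.2 (lt_of_lt_of_le hi hj)
  refine sStarD_nonneg_transfer e (fun B' C' hB' hC' => sStarD_cylSet_starLiteral_nonneg (m := (T ∪ S)ᶜ.card) (T.card + S.card) κ thr w
    hthr' hord hB' hC') (fun p => ?_) B C hB hC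
  rw [Finset.mem_filter, mem_cylSet_iff, Finset.mem_filter]
  simp only [Finset.mem_univ, true_and]
  have lit : (∃ i ∈ T, u i ≤ p i) ↔ (∃ i, κ i = true ∧ thr i ≤ cellOf (p ∘ e) i) := by
    constructor
    · rintro ⟨s, hs, hle⟩
      obtain ⟨i', hi'⟩ := hs1 s hs
      refine ⟨Fin.castAdd S.card i', hκ1 i', ?_⟩
      rw [hthr]; simp only [cellOf, Function.comp_apply]; rw [hi']; exact hle
    · rintro ⟨i, hi, hle⟩
      rw [hκ] at hi; simp only [decide_eq_true_eq] at hi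
      have ei : i = Fin.castAdd S.card ⟨i.val, hi⟩ := Fin.ext rfl
      refine ⟨e (Fin.natAdd _ (Fin.castAdd S.card ⟨i.val, hi⟩)), he1 _, ?_⟩
      rw [ei, hthr] at hle; simpa [cellOf] using hle
  have orth : (∀ a ∈ S, u a ≤ p a) ↔ (∀ i, κ i = false → thr i ≤ cellOf (p ∘ e) i) := by
    constructor
    · intro h i hi
      rw [hκ] at hi; simp only [decide_eq_false_iff_not, not_lt] at hi
      obtain ⟨j, hj⟩ : ∃ j : Fin S.card, i = Fin.natAdd T.card j :=
        ⟨⟨i.val - T.card, by omega⟩, Fin.ext (by simp; omega)⟩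
      rw [hj, hthr]; simp only [cellOf, Function.comp_apply]
      exact h _ (he2 j)
    · intro h a ha
      obtain ⟨j, hj⟩ := hs2 a ha
      have := h (Fin.natAdd T.card j) (hκ2 j)
      rw [hthr] at this; simp only [cellOf, Function.comp_apply] at this; rw [hj] at this; exact this
  rw [lit, orth]

/-! ### Value level: Kahn's inequality for a clause ∨ monomial -/

variable {d K : ℕ}

/-- **The symmetrised pattern value of (clause ∨ monomial, up-set, up-set) is nonnegative** at every three-point sample `ω` of the grid:
after sorting, the first event pulls back to a star of literals and one orthant (thresholds in `{1,2}`), to the whole cube, or loses blocks. [this work] -/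
theorem Ssym_nonneg_clauseOrthant (T S : Finset (Fin d)) (hdisj : Disjoint T S) (c : Fin d → Fin (K + 1)) (w : Bool)
    {B C : Finset (Xd d K)} (hB : IsUpperSet (B : Set (Xd d K))) (hC : IsUpperSet (C : Set (Xd d K))) (ω : Fin 3 → Xd d K) :
    0 ≤ Ssym (univ.filter fun x : Xd d K => (∃ i ∈ T, c i ≤ x i) ∨ (w = true ∧ ∀ a ∈ S, c a ≤ x a)) B C ω := by
  classical
  set A : Finset (Xd d K) := univ.filter fun x : Xd d K => (∃ i ∈ T, c i ≤ x i) ∨ (w = true ∧ ∀ a ∈ S, c a ≤ x a) with hAdef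
  let σ : Fin d → Equiv.Perm (Fin 3) := fun a => Tuple.sort fun cc => ω cc a
  have hsort : ∀ a, Monotone fun cc => Tmap σ ω cc a := fun a => by
    show Monotone ((fun cc => ω cc a) ∘ σ a)
    exact Tuple.monotone_sort _
  rw [← S_Tmap A B C σ ω, S_eq_sStarD]
  set ω' : Fin 3 → Xd d K := Tmap σ ω with hω'
  have hB' := isUpperSet_pb hsort hB
  have hC' := isUpperSet_pb hsort hC
  have mem_pb : ∀ p : Pd d, p ∈ pb ω' A ↔ ((∃ i ∈ T, c i ≤ ω' (p i) i) ∨ (w = true ∧ ∀ a ∈ S, c a ≤ ω' (p a) a)) := by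
    intro p; unfold pb; rw [Finset.mem_filter, hAdef, Finset.mem_filter]; simp
  have ax : ∀ a : Fin d, (∀ cc : Fin 3, ¬ c a ≤ ω' cc a) ∨ ∃ t : Fin 3, ∀ cc : Fin 3, (c a ≤ ω' cc a ↔ t ≤ cc) :=
    fun a => threshold_three_le (fun cc => ω' cc a) (hsort a) (c a)
  -- per-axis threshold (or `none` = never satisfied)
  have ht : ∀ a, ∃ o : Option (Fin 3), (o = none → ∀ cc : Fin 3, ¬ c a ≤ ω' cc a) ∧ (∀ t, o = some t → ∀ cc : Fin 3, (c a ≤ ω' cc a ↔ t ≤ cc)) := by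
    intro a
    rcases ax a with h | ⟨t, h⟩
    · refine ⟨none, fun _ => h, ?_⟩
      intro t ht; exact absurd ht (by simp)
    · refine ⟨some t, ?_, ?_⟩
      · intro h'; exact absurd h' (by simp)
      · intro t' ht'
        rw [Option.some.injEq] at ht'
        subst ht'
        exact h
  choose o ho1 ho2 using ht
  -- a literal that is always satisfied: the slot is the whole cube
  by_cases hzero : ∃ i ∈ T, o i = some 0
  · obtain ⟨i, hi, hoi⟩ := hzero
    have e : pb ω' A = univ := by
      refine Finset.eq_univ_of_forall fun p => (mem_pb p).2 (Or.inl ⟨i, hi, ?_⟩)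
      exact (ho2 i 0 hoi (p i)).2 (Fin.zero_le _)
    rw [e]; exact sStarD_nonneg_of_eq_univ₁ hB' hC'
  -- otherwise: surviving literals `T'`, thresholds `u`, orthant flag `w'`
  set T' : Finset (Fin d) := T.filter fun i => o i ≠ none with hT'
  set u : Fin d → Fin 3 := fun a => (o a).getD 0 with hudef
  set w' : Bool := (w && decide (∀ a ∈ S, o a ≠ none)) with hw'
  have hdisj' : Disjoint T' S := Finset.disjoint_of_subset_left (Finset.filter_subset _ _) hdisj
  have hu : ∀ i ∈ T', u i ≠ 0 := by
    intro i hi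
    rw [hT', Finset.mem_filter] at hi
    obtain ⟨t, hti⟩ := Option.ne_none_iff_exists'.1 hi.2
    have hut : u i = t := by rw [hudef]; simp [hti]
    rw [hut]; intro ht0
    exact hzero ⟨i, hi.1, by rw [hti, ht0]⟩
  have e : pb ω' A = univ.filter fun p : Pd d => (∃ i ∈ T', u i ≤ p i) ∨ (w' = true ∧ ∀ a ∈ S, u a ≤ p a) := by
    ext p; rw [mem_pb, Finset.mem_filter]
    simp only [Finset.mem_univ, true_and]
    have litA : (∃ i ∈ T, c i ≤ ω' (p i) i) ↔ (∃ i ∈ T', u i ≤ p i) := by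
      constructor
      · rintro ⟨i, hi, hle⟩
        have hne : o i ≠ none := fun hn => ho1 i hn (p i) hle
        obtain ⟨t, hti⟩ := Option.ne_none_iff_exists'.1 hne
        refine ⟨i, by rw [hT', Finset.mem_filter]; exact ⟨hi, hne⟩, ?_⟩
        have hut : u i = t := by rw [hudef]; simp [hti]
        rw [hut]; exact (ho2 i t hti (p i)).1 hle
      · rintro ⟨i, hi, hle⟩
        rw [hT', Finset.mem_filter] at hi
        obtain ⟨t, hti⟩ := Option.ne_none_iff_exists'.1 hi.2
        have hut : u i = t := by rw [hudef]; simp [hti]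
        exact ⟨i, hi.1, (ho2 i t hti (p i)).2 (by rw [← hut]; exact hle)⟩
    have orthA : (w = true ∧ ∀ a ∈ S, c a ≤ ω' (p a) a) ↔ (w' = true ∧ ∀ a ∈ S, u a ≤ p a) := by
      rw [hw']
      simp only [Bool.and_eq_true, decide_eq_true_eq]
      constructor
      · rintro ⟨hw, h⟩
        have hne : ∀ a ∈ S, o a ≠ none := fun a ha hn => ho1 a hn (p a) (h a ha)
        refine ⟨⟨hw, hne⟩, fun a ha => ?_⟩
        obtain ⟨t, hta⟩ := Option.ne_none_iff_exists'.1 (hne a ha)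
        have hut : u a = t := by rw [hudef]; simp [hta]
        rw [hut]; exact (ho2 a t hta (p a)).1 (h a ha)
      · rintro ⟨⟨hw, hne⟩, h⟩
        refine ⟨hw, fun a ha => ?_⟩
        obtain ⟨t, hta⟩ := Option.ne_none_iff_exists'.1 (hne a ha)
        have hut : u a = t := by rw [hudef]; simp [hta]
        exact (ho2 a t hta (p a)).2 (by rw [← hut]; exact h a ha)
    rw [litA, orthA]
  rw [e]
  exact sStarD_clauseOrthant_nonneg T' S hdisj' u hu w' hB' hC'

/-- **SAHI'S `C₃` / KAHN'S INEQUALITY WITH A CLAUSE-OR-MONOMIAL SLOT ON EVERY GRID, homogeneous form** (every `d, K`). [this work] -/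
theorem latticeE3_gridProd_nonneg_clauseOrthant (g : Fin d → Fin (K + 1) → ℝ) (hg : ∀ a v, 0 ≤ g a v)
    (T S : Finset (Fin d)) (hdisj : Disjoint T S) (c : Fin d → Fin (K + 1)) (w : Bool)
    {B C : Finset (Xd d K)} (hB : IsUpperSet (B : Set (Xd d K))) (hC : IsUpperSet (C : Set (Xd d K))) :
    0 ≤ latticeE3 (fun ω : Xd d K => ∏ a, g a (ω a))
      (univ.filter fun x : Xd d K => (∃ i ∈ T, c i ≤ x i) ∨ (w = true ∧ ∀ a ∈ S, c a ≤ x a)) B C := by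
  have hcard : (0 : ℝ) < Fintype.card (Fin d → Equiv.Perm (Fin 3)) := by exact_mod_cast Fintype.card_pos
  have h := latticeE3_symm g (univ.filter fun x : Xd d K => (∃ i ∈ T, c i ≤ x i) ∨ (w = true ∧ ∀ a ∈ S, c a ≤ x a)) B C
  have hsum : 0 ≤ ∑ ω : Fin 3 → Xd d K, (∏ cc, ∏ a, g a (ω cc a)) *
      (Ssym (univ.filter fun x : Xd d K => (∃ i ∈ T, c i ≤ x i) ∨ (w = true ∧ ∀ a ∈ S, c a ≤ x a)) B C ω : ℝ) :=
    Finset.sum_nonneg fun ω _ => mul_nonneg (Finset.prod_nonneg fun cc _ => Finset.prod_nonneg fun a _ => hg a _)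
      (by exact_mod_cast Ssym_nonneg_clauseOrthant T S hdisj c w hB hC ω)
  rw [← h] at hsum
  exact (mul_nonneg_iff_of_pos_left hcard).1 hsum

/-- **KAHN'S `E₃ ≥ 0` FOR A CLAUSE ∨ MONOMIAL** (probability form, every grid): for every product probability weight `⊗ g_i` on `[K+1]^d`,
disjoint variable sets `T, S`, thresholds `c`, a flag `w`, and all increasing events `B, C`:
`0 ≤ E₃(1_A, 1_B, 1_C)` for `A = {x : (∃ i ∈ T, c i ≤ x i) ∨ (w ∧ ∀ a ∈ S, c a ≤ x a)}` — Kahn's Conjecture 5 / Sahi's `C₃` when one of the three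
increasing events is a read-once monotone DNF with at most one term of width ≥ 2 (for `w = false`: a monotone clause). [this work] -/
theorem sahiE_three_clauseOrthant_nonneg (g : Fin d → Fin (K + 1) → ℝ) (hg0 : ∀ i v, 0 ≤ g i v) (hg1 : ∀ i, ∑ v, g i v = 1)
    (T S : Finset (Fin d)) (hdisj : Disjoint T S) (c : Fin d → Fin (K + 1)) (w : Bool)
    {B C : Finset (Xd d K)} (hB : IsUpperSet (B : Set (Xd d K))) (hC : IsUpperSet (C : Set (Xd d K))) :
    0 ≤ sahiE (fun ω : Xd d K => ∏ i, g i (ω i)) 3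
      ![setInd (univ.filter fun x : Xd d K => (∃ i ∈ T, c i ≤ x i) ∨ (w = true ∧ ∀ a ∈ S, c a ≤ x a)), setInd B, setInd C] := by
  classical
  have hsum : ∑ ω : Fin d → Fin (K + 1), ∏ i, g i (ω i) = 1 := by
    rw [← Fintype.prod_sum]; simp [hg1]
  rw [sahiE_three_indicator_eq_latticeE3 hsum]
  exact latticeE3_gridProd_nonneg_clauseOrthant g hg0 T S hdisj c w hB hC

end Summit.CriticalPhenomena.PercolationContinuityZ3.Theorems.SahiGridPattern
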